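import Literature.NumberTheory.EllipticCurves.CompactSelmerTowerNormProofs
import Literature.NumberTheory.EllipticCurves.HeegnerEnvelopeReverseCoherentProofs
import Summits.BirchSwinnertonDyer.BirchSwinnertonDyer.Theorems.CumulativeHeegnerLeopoldtCumulativeHeegnerInclusionAtThreeCellNoThreeTorsion
import HarnessLib

/-!
# Route `CumulativeHeegnerLeopoldt`, crux K1 `CumulativeHeegnerInclusionAtThree` (stmt-BirchSwinnertonDyer-24198),
# line `birth`, stub A (= crux stmt-26896 `TemperedHeegnerInclusionAtThree`): a KERNEL BARRIER LEMMA —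
# Howard's `Λ`-adic Heegner module `ℋ_∞(F)` VANISHES for a TRACE-ZERO Heegner family

Lead prover bsd-line-chl-k1-p1 g3, `--supports stmt-BirchSwinnertonDyer-24198`. THEOREMS ONLY (no definition,
no named fact, no `sorry`), on the vocabulary of `Literature/…/HeegnerModuleIndex.lean` (`HeegnerFamily`,
`LambdaAdicSelmerData`, `heegnerModuleLayer`, `heegnerModule`) and the operator algebra of
`CompactSelmerTowerNormProofs` (seat x9-p2). Generic in the prime `p`, the level `N` (the TYPE
`HeegnerFamily N W K κ jbar` allows `p ∣ N`), the curve and the field.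

WHY (stub A of K1). On the Leopoldt cell the prime `3` is ADDITIVE (`a₃ = 0`, `9 ∣ N`): the vertical
distribution relation of CM points of `3`-power conductor is `Tr_{K[3^{s+1}]/K[3^s]} x_{s+1} = U₃·x_s`, whence on
`E` every norm point `z_{j+1} = Norm_{K[3^{j+2}]/K_{j+1}} P[3^{j+2}]` has TRACE ZERO to `K_j` (evidence #28 §2–§3
on the item; the informal crux text: «a₃ = 0 forces Tr y_{3^(k+1)} = 0 (no bounded norm-compatible Heegner
family)»). This file proves, in the kernel and on the tree's actual Howard objects, what that does to every
Howard-currency statement: if the norm points of a `HeegnerFamily F` are trace-zero up the `ℤ_p`-tower and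
`E(K)[p] = 0` (landed on the cell: `…CellNoThreeTorsion`, p615628), then

  `heegnerModule D F = ⊥`                                    (`heegnerModule_eq_bot_of_traceZero`)

for EVERY `Λ`-adic Selmer datum `D` — so `heegnerCharIdeal D F = char_Λ(𝔖)` and Howard-shaped divisibilities
(`Howard2004_thmB`, `CastellaGrossiSkinner2025.thmC…`, `BurungaleCastellaSkinner2025.thm421a…`:
`char(X_tors) ∣ char(𝔖/ℋ_∞)²`) carry no Heegner information at a trace-zero prime. Consequently an A-line
cannot be phrased in Howard's integral currency: it must carry a TEMPERED (non-integral, `Λ ⊗ 𝓗₁`-valued)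
class — the cumulative class of the crux text (temper 1, `…CumulativeClass` p617614 / `…GammaBallSystem`
p619789) or an `α`-stabilised class on the principal-series sub-cell (temper 1/2). This is a barrier lemma for
the ideation / triage of A 26896, not a step toward BSD; BSD is not proved by any of this.

THE ARGUMENT (Perrin-Riou 1987 §3.4 Prop. 10 «il est nul sinon», made unconditional on `e_{cp^n}` having
infinite order by the trace-zero hypothesis). Let `s ∈ 𝔖` have all its projections `x_k = proj_k s` in the
level modules `ℋ̄_k = ℤ_p[G_k]·{δy, δz_0, …, δz_k}`. One step of universal norms (`proj_norm`):
`res_{k→k+1} x_k = 𝒩 x_{k+1}`, `𝒩 = Σ_{i<p} conj_{γ^{p^k i}}`. On generators of `ℋ̄_{k+1}`: the Kummer family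
of `z_{k+1}` has `𝒩 δ(z_{k+1}) = δ(Tr_{K_{k+1}/K_k} z_{k+1}) = δ(0) = 0`, and the Kummer family of a
`K_k`-rational generator `w ∈ {y, z_0, …, z_k}` has `𝒩 δ_{k+1}(w) = p · res δ_k(w)`
(`sum_conjPi_eq_pow_smul_of_isKummerFamilyOver`, `eq_resPi_of_isKummerFamilyOver`); both operators commute with
`ℤ_p[G]`. Hence `𝒩 ℋ̄_{k+1} ⊆ res (p·ℋ̄_k)` (§1), so `res x_k ∈ res(p ℋ̄_k)` and, restriction being injective
under `E(K)[p] = 0` (`resPi_layer_injective_of_noPTorsion`), `x_k ∈ p ℋ̄_k`; iterating along the tower,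
`x_k ∈ p^m ℋ̄_k` for every `m` (§2). But the `m`-th component of `∏_m H¹(K_k, E[p^m])` is killed by `p^m`
(`pow_smul_torsionH1Over_eq_zero`), so `x_k = 0` for all `k`, `s = 0` (`LambdaAdicSelmerData.ext`), and
`ℋ_∞(F) = Λ·{such s} = ⊥` (§3).

References: [PerrinRiou1987BSMF] §3.4 Prop. 10 («S'il existe un entier n tel que e_{cp^n} est d'ordre infini,
le Λ-module ℋ_∞ est libre de rang 1; il est nul sinon»), §0 p. 402 (universal norms);
[Howard2004HeegnerKolyvagin] §3.3 (`H_k`, `𝐇 = lim← H_k`); [GreenbergLNM1716] §3 Lemma 3.1 (kernel of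
restriction); evidence #28 on stmt-BirchSwinnertonDyer-24198 (A-LINE-INPUT-AUDIT-w2g0 §2–§3: trace-zero at 9 ∣ N).
-/

set_option autoImplicit false
set_option linter.dupNamespace false

noncomputable section

open scoped Classical

open WeierstrassCurve Literature.NumberTheory.EllipticCurves PowerSeries

universe u

namespace Summit.BirchSwinnertonDyer.BirchSwinnertonDyer.Theorems.CumulativeHeegnerInclusionAtThreeTraceZero

variable {K : Type u} [Field K] [NumberField K] {N : ℕ} [NeZero N] {W : WeierstrassCurve ℚ} [W.IsElliptic]
  {p : ℕ} [Fact p.Prime] {κ : ZpExtension K p} {γ : Field.absoluteGaloisGroup K}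
  {jbar : AlgebraicClosure K →+* ℂ}

/-! ## §1 One step of universal norms on the level modules: `𝒩 ℋ̄_{k+1}(F) ⊆ res (p · ℋ̄_k(F))` -/

/-- **One norm step on the level Heegner modules of a trace-zero family.** If `Tr_{K_{k+1}/K_k} z_{k+1} = 0`
(as a sum over `Gal(K_{k+1}/K_k) = {γ^{p^k i}}_{i<p}`), then for every `x ∈ ℋ̄_{k+1}(F)` there is
`y ∈ ℋ̄_k(F)` with `Σ_{i<p} conj_{γ^{p^k i}} x = res_{k→k+1} (p • y)`: on the Kummer family of `z_{k+1}` the norm is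
the Kummer family of the trace, i.e. of `0`; on the Kummer family of a `K_k`-rational generator it is `p` times
the restriction of the level-`k` Kummer family; `c ·` and `conj_{γ^i}` commute with both sides.
[cite: PerrinRiou1987BSMF, §0 p. 402 and §3.4 (ℋ_n, traces)] [cite: Howard2004HeegnerKolyvagin, §3.3 (H_k)] -/
theorem exists_sum_conjPi_eq_resPi_smul_of_mem_heegnerModuleLayer (hγ : κ.IsTopGenerator γ)
    (F : HeegnerFamily N W K κ jbar) (k : ℕ)
    (hTZ : ∑ i ∈ Finset.range p, (γ ^ (p ^ k * i)) • F.z (k + 1) = 0)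
    {x : (W.baseChange K).torsionH1Pi p (κ.layerSubgroup (k + 1))} (hx : x ∈ heegnerModuleLayer γ F (k + 1)) :
    ∃ y ∈ heegnerModuleLayer γ F k,
      ∑ i ∈ Finset.range p, (W.baseChange K).conjPi p (κ.layerSubgroup (k + 1)) (γ ^ (p ^ k * i)) x =
        (W.baseChange K).resPi p (κ.layerSubgroup_antitone (Nat.le_succ k)) ((p : ℤ) • y) := by
  haveI : (W.baseChange K).IsElliptic := inferInstanceAs (W.map (algebraMap ℚ K)).IsElliptic
  have hle : κ.layerSubgroup (k + 1) ≤ κ.layerSubgroup k := κ.layerSubgroup_antitone (Nat.le_succ k)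
  -- the norm operator and the restriction, as additive homomorphisms
  obtain ⟨𝒩, h𝒩ap⟩ : ∃ 𝒩 : (W.baseChange K).torsionH1Pi p (κ.layerSubgroup (k + 1)) →+
      (W.baseChange K).torsionH1Pi p (κ.layerSubgroup (k + 1)),
      ∀ x, 𝒩 x = ∑ i ∈ Finset.range p, (W.baseChange K).conjPi p (κ.layerSubgroup (k + 1)) (γ ^ (p ^ k * i)) x :=
    ⟨∑ i ∈ Finset.range p, (W.baseChange K).conjPi p (κ.layerSubgroup (k + 1)) (γ ^ (p ^ k * i)),
      fun x ↦ by rw [AddMonoidHom.finsetSum_apply]⟩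
  obtain ⟨res, hres⟩ : ∃ res : (W.baseChange K).torsionH1Pi p (κ.layerSubgroup k) →+
      (W.baseChange K).torsionH1Pi p (κ.layerSubgroup (k + 1)), ∀ y, res y = (W.baseChange K).resPi p hle y :=
    ⟨_, fun _ ↦ rfl⟩
  -- the predicate `∃ y ∈ ℋ̄_k, 𝒩 x = res (p • y)`, closed under the group operations
  suffices h : ∃ y ∈ heegnerModuleLayer γ F k, 𝒩 x = res ((p : ℤ) • y) by
    obtain ⟨y, hy, h⟩ := h
    exact ⟨y, hy, by rw [← h𝒩ap, h, hres]⟩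
  refine AddSubgroup.closure_induction (p := fun x _ ↦ ∃ y ∈ heegnerModuleLayer γ F k, 𝒩 x = res ((p : ℤ) • y))
    ?_ ?_ ?_ ?_ hx
  · -- generators `c · conj_{γ^i} d`, `d` the Kummer family of `w ∈ {y, z_0, …, z_{k+1}}`
    rintro _ ⟨c, i, w, hw, d, hd, rfl⟩
    have hd' : (W.baseChange K).IsKummerFamilyOver p (κ.layerSubgroup (k + 1))
        (fun σ hσ ↦ F.smul_eq_of_mem_generators hw hσ) d := fun m Q hQ ↦ hd m Q hQ
    -- transport through `c ·` and `conj_{γ^i}`: it suffices to treat `d` itself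
    suffices hdN : ∃ y ∈ heegnerModuleLayer γ F k, 𝒩 d = res ((p : ℤ) • y) by
      obtain ⟨y, hy, hyd⟩ := hdN
      refine ⟨(W.baseChange K).padicPi p (κ.layerSubgroup k) c
        ((W.baseChange K).conjPi p (κ.layerSubgroup k) (γ ^ i) y), ?_, ?_⟩
      · -- `ℋ̄_k` is `ℤ_p[G_k]`-stable: check on its generators, then on the closure
        revert hy
        refine fun hy ↦ AddSubgroup.closure_induction
          (p := fun y _ ↦ (W.baseChange K).padicPi p (κ.layerSubgroup k) c
            ((W.baseChange K).conjPi p (κ.layerSubgroup k) (γ ^ i) y) ∈ heegnerModuleLayer γ F k) ?_ ?_ ?_ ?_ hy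
        · rintro _ ⟨c', i', w', hw', d', hd'', rfl⟩
          refine AddSubgroup.subset_closure ⟨c * c', i + i', w', hw', d', hd'', ?_⟩
          rw [conjPi_padicPi_comm, padicPi_padicPi, ← conjPi_mul, ← pow_add]
        · rw [map_zero, map_zero]; exact AddSubgroup.zero_mem _
        · intro a b _ _ ha hb
          rw [map_add, map_add]; exact AddSubgroup.add_mem _ ha hb
        · intro a _ ha
          rw [map_neg, map_neg]; exact AddSubgroup.neg_mem _ ha
      · rw [h𝒩ap, sum_conjPi_padicPi, sum_conjPi_pow_conjPi_pow, ← h𝒩ap, hyd, hres, hres, ← resPi_conjPi,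
          ← resPi_padicPi, map_zsmul, map_zsmul]
    -- a `K_k`-rational generator: `𝒩 δ_{k+1}(w) = p · res δ_k(w)`
    have hrat : ∀ (hwk : w ∈ F.generators k), ∃ y ∈ heegnerModuleLayer γ F k, 𝒩 d = res ((p : ℤ) • y) := by
      intro hwk
      have hwfix : ∀ σ ∈ κ.layerSubgroup k, σ • w = w := fun σ hσ ↦ F.smul_eq_of_mem_generators hwk hσ
      obtain ⟨dk, hdk⟩ := exists_isKummerFamilyOver (W.baseChange K) p (κ.layerSubgroup k) _ hwfix
      refine ⟨dk, mem_heegnerModuleLayer_of_isKummerFamilyOver_generator F γ k hwk hdk, ?_⟩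
      have hN := (W.baseChange K).sum_conjPi_eq_pow_smul_of_isKummerFamilyOver p κ hγ (n := 1) hle hwfix hd'
      rw [pow_one, pow_one] at hN
      rw [h𝒩ap, hN, (W.baseChange K).eq_resPi_of_isKummerFamilyOver p κ hle hwfix hdk hd', hres, map_zsmul]
    -- the two kinds of generators
    rcases hw with hw | ⟨j, hj, hjw⟩
    · -- `w = y_K`, rational over `K = K_0 ⊆ K_k`
      exact hrat (Set.mem_union_left _ hw)
    · rcases Nat.lt_or_ge j (k + 1) with hjk | hjk
      · -- `w = z_j`, `j ≤ k`: rational over `K_j ⊆ K_k`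
        exact hrat (Set.mem_union_right _ ⟨j, Set.mem_setOf.mpr (Nat.lt_succ_iff.mp hjk), hjw⟩)
      · -- `w = z_{k+1}`: the norm of its Kummer family is the Kummer family of the trace `= 0`
        have hjeq : j = k + 1 := le_antisymm hj hjk
        subst hjeq
        subst hjw
        refine ⟨0, AddSubgroup.zero_mem _, ?_⟩
        -- `conj_{γ^{p^k i}} d` is the Kummer family of `γ^{p^k i} • z_{k+1}`; sum them up
        have hfix : ∀ (i : ℕ), ∀ τ ∈ κ.layerSubgroup (k + 1),
            τ • ((γ ^ (p ^ k * i)) • F.z (k + 1)) = (γ ^ (p ^ k * i)) • F.z (k + 1) := by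
          intro i τ hτ
          rw [← mul_smul, show τ * γ ^ (p ^ k * i) = γ ^ (p ^ k * i) * ((γ ^ (p ^ k * i))⁻¹ * τ * γ ^ (p ^ k * i))
            by group, mul_smul, F.smul_eq_of_mem_generators (k := k + 1)
              (Set.mem_union_right _ ⟨k + 1, Set.mem_setOf.mpr le_rfl, rfl⟩)
            (conj_mem_of_normal (κ.layerSubgroup (k + 1)) (γ ^ (p ^ k * i)) ⟨τ, hτ⟩)]
        have hsum := IsKummerFamilyOver.sum (p := p) (Finset.range p)
          (P := fun i ↦ (γ ^ (p ^ k * i)) • F.z (k + 1))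
          (d := fun i ↦ (W.baseChange K).conjPi p (κ.layerSubgroup (k + 1)) (γ ^ (p ^ k * i)) d)
          (hP := hfix) (fun i ↦ hd'.conjPi (γ ^ (p ^ k * i)))
        have h0 := IsKummerFamilyOver.unique p (IsKummerFamilyOver.of_eq hTZ hsum)
          (isKummerFamilyOver_zero (V := W.baseChange K) (H' := κ.layerSubgroup (k + 1)) (p := p))
        rw [h𝒩ap, h0, zsmul_zero, map_zero]
  · exact ⟨0, AddSubgroup.zero_mem _, by rw [map_zero, zsmul_zero, map_zero]⟩
  · rintro a b _ _ ⟨ya, hya, ha⟩ ⟨yb, hyb, hb⟩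
    exact ⟨ya + yb, AddSubgroup.add_mem _ hya hyb, by rw [map_add, ha, hb, zsmul_add, map_add]⟩
  · rintro a _ ⟨ya, hya, ha⟩
    exact ⟨-ya, AddSubgroup.neg_mem _ hya, by rw [map_neg, ha, zsmul_neg, map_neg]⟩

/-! ## §2 Restriction along the tower is injective when `E(K_∞)[p^∞] = 0` -/

omit [W.IsElliptic] in
/-- **`res : ∏_m H¹(K_k, E[p^m]) → ∏_m H¹(K_ℓ, E[p^m])` is injective when `E(K_∞)[p^∞] = 0`**, stated with
the fixed-point hypothesis `(E_K[p^∞])^{Gal(K̄/K_∞)} = 0` itself (the tree's `resPi_layer_injective_of_noPTorsion`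
derives that hypothesis from `E(K)[p] = 0`; on the Leopoldt cell it is `…CellNoThreeTorsion.cell_fixedPoints_kerSubgroup_eq_bot`):
componentwise inflation–restriction, the kernel living on `E[p^m]^{Gal(K̄/K_ℓ)} ⊆ E(K_∞)[p^∞] = 0`.
[cite: GreenbergLNM1716, §3 Lemma 3.1 (ker of restriction in the tower ≅ H¹(Γ_n, E(F_∞)[p^∞]))] -/
theorem resPi_layer_injective_of_fixedPoints_eq_bot
    (hbot : FixedPoints.addSubgroup κ.kerSubgroup ((W.baseChange K).geomPrimaryTorsion p) = ⊥) {k ℓ : ℕ}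
    (h : κ.layerSubgroup ℓ ≤ κ.layerSubgroup k) : Function.Injective ((W.baseChange K).resPi p h) := by
  have hfix : ∀ (m : ℕ) (x : geomTorsion (W.baseChange K) ((p : ℤ) ^ m)),
      (∀ σ ∈ κ.layerSubgroup ℓ, σ • x = x) → x = 0 := by
    intro m x hx
    have hmem : (x : geomPoints (W.baseChange K)) ∈ geomPrimaryTorsion (W.baseChange K) p := by
      refine (AddCommGroup.mem_primaryComponent).mpr ⟨m, ?_⟩
      have := (mem_geomTorsion_iff (W.baseChange K) _ _).mp x.2
      rwa [← natCast_zsmul, Nat.cast_pow]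
    have hx' : (⟨(x : geomPoints (W.baseChange K)), hmem⟩ : geomPrimaryTorsion (W.baseChange K) p) ∈
        FixedPoints.addSubgroup κ.kerSubgroup (geomPrimaryTorsion (W.baseChange K) p) := by
      rw [FixedPoints.mem_addSubgroup]
      rintro ⟨τ, hτ⟩
      apply Subtype.ext
      rw [Subgroup.mk_smul, primaryComponent.coe_smul]
      have := hx τ (κ.kerSubgroup_le_layerSubgroup ℓ hτ)
      rw [← AddSubgroup.torsionBy.coe_smul, this]
    rw [hbot, AddSubgroup.mem_bot] at hx'
    have hx0 : (x : geomPoints (W.baseChange K)) = 0 := congrArg Subtype.val hx'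
    exact Subtype.ext hx0
  intro y y' hyy'
  funext m
  have hm := congrFun hyy' m
  simp only [resPi, AddMonoidHom.pi_apply, AddMonoidHom.coe_comp, Function.comp_apply,
    Pi.evalAddMonoidHom_apply] at hm
  exact resOfLe_injective_of_forall_fixed_eq_zero (M := geomTorsion (W.baseChange K) ((p : ℤ) ^ m)) h (hfix m) hm

/-! ## §3 Iteration along the tower: the projections of `ℋ_∞`-candidates are `p`-divisible to all orders -/

/-- **`proj_k s ∈ p^m ℋ̄_k(F)` for every `m`.** Let the norm points of `F` be trace-zero up the tower and
`E(K_∞)[p^∞] = 0`. If `s ∈ 𝔖` has `proj_ℓ s ∈ ℋ̄_ℓ(F)` for every layer `ℓ`, then for all `m` and `k` there is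
`y ∈ ℋ̄_k(F)` with `proj_k s = p^m • y` (induction on `m`, using §1 at the layer `k + 1`, the one-step universal
norm relation `proj_norm` and the injectivity of restriction §2).
[cite: PerrinRiou1987BSMF, §0 p. 402 (universal norms) and §3.4 Prop. 10] [cite: GreenbergLNM1716, §3 Lemma 3.1] -/
theorem exists_proj_eq_pow_smul_of_traceZero (hγ : κ.IsTopGenerator γ)
    (hbot : FixedPoints.addSubgroup κ.kerSubgroup ((W.baseChange K).geomPrimaryTorsion p) = ⊥)
    (D : (W.baseChange K).LambdaAdicSelmerData κ γ) (F : HeegnerFamily N W K κ jbar)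
    (hTZ : ∀ j, ∑ i ∈ Finset.range p, (γ ^ (p ^ j * i)) • F.z (j + 1) = 0)
    {s : D.S} (hs : ∀ ℓ, D.proj ℓ s ∈ heegnerModuleLayer γ F ℓ) (m k : ℕ) :
    ∃ y ∈ heegnerModuleLayer γ F k, D.proj k s = ((p : ℤ) ^ m) • y := by
  induction m generalizing k with
  | zero => exact ⟨D.proj k s, hs k, by rw [pow_zero, one_zsmul]⟩
  | succ m ih =>
    obtain ⟨y', hy', hy'eq⟩ := ih (k + 1)
    obtain ⟨y, hy, hyeq⟩ := exists_sum_conjPi_eq_resPi_smul_of_mem_heegnerModuleLayer hγ F k (hTZ k) hy'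
    refine ⟨y, hy, ?_⟩
    have hle : κ.layerSubgroup (k + 1) ≤ κ.layerSubgroup k := κ.layerSubgroup_antitone (Nat.le_succ k)
    -- `res (proj_k s) = 𝒩 (proj_{k+1} s) = 𝒩 (p^m • y') = p^m • res (p • y) = res (p^(m+1) • y)`
    have hnorm := D.proj_norm k s
    rw [hy'eq, (W.baseChange K).sum_conjPi_zsmul p (κ.layerSubgroup (k + 1)) (Finset.range p)
      (fun i ↦ γ ^ (p ^ k * i)) (((p : ℤ)) ^ m) y', hyeq, ← map_zsmul, ← mul_zsmul, ← pow_succ] at hnorm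
    exact resPi_layer_injective_of_fixedPoints_eq_bot hbot hle hnorm

/-! ## §4 The `Λ`-adic Heegner module of a trace-zero family vanishes -/

/-- **Candidates vanish**: under the hypotheses of §3, an `s ∈ 𝔖` all of whose projections lie in the level
modules `ℋ̄_ℓ(F)` is `0` — its level-`k` projection is `p^m`-divisible for every `m`, and the `m`-th component of
`∏_m H¹(K_k, E[p^m])` is killed by `p^m`. [cite: PerrinRiou1987BSMF, §3.4 Prop. 10 («il est nul sinon»)] -/
theorem eq_zero_of_forall_proj_mem_heegnerModuleLayer_of_traceZero (hγ : κ.IsTopGenerator γ)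
    (hbot : FixedPoints.addSubgroup κ.kerSubgroup ((W.baseChange K).geomPrimaryTorsion p) = ⊥)
    (D : (W.baseChange K).LambdaAdicSelmerData κ γ) (F : HeegnerFamily N W K κ jbar)
    (hTZ : ∀ j, ∑ i ∈ Finset.range p, (γ ^ (p ^ j * i)) • F.z (j + 1) = 0)
    {s : D.S} (hs : ∀ ℓ, D.proj ℓ s ∈ heegnerModuleLayer γ F ℓ) : s = 0 := by
  refine D.ext s fun k ↦ ?_
  funext m
  obtain ⟨y, -, hy⟩ := exists_proj_eq_pow_smul_of_traceZero hγ hbot D F hTZ hs m k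
  calc D.proj k s m = (((p : ℤ) ^ m) • y) m := by rw [hy]
    _ = ((p : ℤ) ^ m) • y m := rfl
    _ = 0 := (W.baseChange K).pow_smul_torsionH1Over_eq_zero (κ.layerSubgroup k) p m (y m)

/-- **BARRIER LEMMA (Howard currency is empty at a trace-zero prime), fixed-point form.** For a Heegner
family `F` whose norm points are TRACE-ZERO up the anticyclotomic `ℤ_p`-tower — `Σ_{i<p} γ^{p^j i} • z_{j+1} = 0`
for every `j`, which is what the vertical distribution relation `Tr = U_p` gives on `E` when `a_p(E) = 0` and
`p² ∣ N` (additive, e.g. the Leopoldt cell at `p = 3`) — and `E(K_∞)[p^∞] = 0`, Howard's / Perrin-Riou's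
`Λ`-adic Heegner module `ℋ_∞(F) ⊆ 𝔖_p(K_∞)` is ZERO, for every `Λ`-adic Selmer datum `D` and topological
generator `γ`. [cite: PerrinRiou1987BSMF, §3.4 Prop. 10] [cite: Howard2004HeegnerKolyvagin, §3.3 (𝐇 = lim← H_k)] -/
theorem heegnerModule_eq_bot_of_traceZero_of_fixedPoints_eq_bot (hγ : κ.IsTopGenerator γ)
    (hbot : FixedPoints.addSubgroup κ.kerSubgroup ((W.baseChange K).geomPrimaryTorsion p) = ⊥)
    (D : (W.baseChange K).LambdaAdicSelmerData κ γ) (F : HeegnerFamily N W K κ jbar)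
    (hTZ : ∀ j, ∑ i ∈ Finset.range p, (γ ^ (p ^ j * i)) • F.z (j + 1) = 0) :
    heegnerModule D F = ⊥ := by
  rw [heegnerModule, Submodule.span_eq_bot]
  intro s hs
  exact eq_zero_of_forall_proj_mem_heegnerModuleLayer_of_traceZero hγ hbot D F hTZ hs

/-- **BARRIER LEMMA, `E(K)[p] = 0` form** (the hypothesis of Howard-type Kolyvagin-system bounds; it gives
`E(K_∞)[p^∞] = 0` by `fixedPoints_kerSubgroup_geomPrimaryTorsion_eq_bot`): for a trace-zero Heegner family,
`ℋ_∞(F) = ⊥`. Hence `heegnerCharIdeal D F = char_Λ(𝔖)` and `heegnerModuleIndex D F = length(𝔖_{(T)})` carry no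
Heegner-point information, and every `Howard2004_thmB`-shaped divisibility is vacuous there: an anticyclotomic
divisibility at such a prime needs a tempered (non-integral) `Λ`-adic class.
[cite: PerrinRiou1987BSMF, §3.4 Prop. 10] [cite: Howard2004HeegnerKolyvagin, §3.3 (𝐇 = lim← H_k)]
[cite: GreenbergLNM1716, §4 p. 109 (E(F_∞)[p^∞] = 0 when E(F)[p] = 0)] -/
theorem heegnerModule_eq_bot_of_traceZero (hγ : κ.IsTopGenerator γ)
    (hE : ∀ P : (W.baseChange K).toAffine.Point, p • P = 0 → P = 0)
    (D : (W.baseChange K).LambdaAdicSelmerData κ γ) (F : HeegnerFamily N W K κ jbar)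
    (hTZ : ∀ j, ∑ i ∈ Finset.range p, (γ ^ (p ^ j * i)) • F.z (j + 1) = 0) :
    heegnerModule D F = ⊥ :=
  heegnerModule_eq_bot_of_traceZero_of_fixedPoints_eq_bot hγ
    ((W.baseChange K).fixedPoints_kerSubgroup_geomPrimaryTorsion_eq_bot κ hE) D F hTZ

/-- **Corollary: the Heegner characteristic ideal of a trace-zero family is `char_Λ(𝔖)` itself**
(`𝔖/ℋ_∞ = 𝔖/0 ≅ 𝔖`). [cite: PerrinRiou1987BSMF, §1 p. 405 (I(H_∞))] -/
theorem heegnerCharIdeal_eq_charIdeal_of_traceZero (hγ : κ.IsTopGenerator γ)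
    (hE : ∀ P : (W.baseChange K).toAffine.Point, p • P = 0 → P = 0)
    (D : (W.baseChange K).LambdaAdicSelmerData κ γ) (F : HeegnerFamily N W K κ jbar)
    (hTZ : ∀ j, ∑ i ∈ Finset.range p, (γ ^ (p ^ j * i)) • F.z (j + 1) = 0) :
    heegnerCharIdeal D F = Module.charIdeal (IwasawaAlgebra p) D.S := by
  rw [heegnerCharIdeal]
  exact Module.charIdeal_eq_of_linearEquiv
    (Submodule.quotEquivOfEqBot _ (heegnerModule_eq_bot_of_traceZero hγ hE D F hTZ))

/-! ## §5 On the Leopoldt cell of crux K1 (`p = 3`): the hypothesis `E(K_∞)[3^∞] = 0` is a tree theorem -/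

section LeopoldtCell

variable {K₀ : Type} [Field K₀] [NumberField K₀] {W₀ : WeierstrassCurve ℚ} [W₀.IsElliptic] [W₀.IsGloballyMinimal]
  {N₀ : ℕ} [NeZero N₀] {κ₃ : ZpExtension K₀ 3} {γ₃ : Field.absoluteGaloisGroup K₀} {jbar₀ : AlgebraicClosure K₀ →+* ℂ}

/-- **BARRIER LEMMA ON THE LEOPOLDT CELL of crux K1 / A** (wild additive `3`, `E[3]` reducible with a
NON-ANOMALOUS rational line, `K` imaginary quadratic Heegner for `N = N_E`): for every `ℤ₃`-extension `κ` with
topological generator `γ`, every `Λ`-adic Selmer datum `D` and every Heegner family `F` at level `N` whose norm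
points are trace-zero up the tower, `ℋ_∞(F) = ⊥`. The torsion input `E(K_∞)[3^∞] = 0` is the landed cell lemma
`…CellNoThreeTorsion.cell_fixedPoints_kerSubgroup_eq_bot` (p615628); the trace-zero relation is the `a₃ = 0`
distribution relation of the crux text (not a tree fact: hypothesis `hTZ`). So stub A / crux 26896 cannot be a
Howard-module statement. [cite: PerrinRiou1987BSMF, §3.4 Prop. 10] [cite: Castella2018Erratum, Lemma 2.1] -/
theorem heegnerModule_eq_bot_on_leopoldtCell
    (hO6 : Summit.BirchSwinnertonDyer.Rank1Residual.Additive.ClassO6 W₀ 3)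
    (hline : ∃ Φ : AddSubgroup (WeierstrassCurve.geomTorsion W₀ ((3 : ℕ) : ℤ)),
        Literature.NumberTheory.EllipticCurves.Rank1Residual.IsRationalLine W₀ 3 Φ ∧
        ∀ (v : IsDedekindDomain.HeightOneSpectrum (NumberField.RingOfIntegers ℚ)),
          ((3 : ℕ) : NumberField.RingOfIntegers ℚ) ∈ v.asIdeal → ∀ 𝔓 ∈ v.primesAbove,
          ¬ (∀ g ∈ 𝔓.decompositionSubgroup (Field.absoluteGaloisGroup ℚ), ∀ P ∈ Φ, g • P = P) ∧
          ¬ (∀ g ∈ 𝔓.decompositionSubgroup (Field.absoluteGaloisGroup ℚ),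
              ∀ P : WeierstrassCurve.geomTorsion W₀ ((3 : ℕ) : ℤ), g • P - P ∈ Φ))
    (hN : W₀.conductorNorm ℤ = N₀) (hK : Literature.NumberTheory.EllipticCurves.IsImaginaryQuadratic K₀)
    (hHg : Literature.NumberTheory.EllipticCurves.SatisfiesHeegnerHypothesis N₀ K₀)
    (hγ : κ₃.IsTopGenerator γ₃) (D : (W₀.baseChange K₀).LambdaAdicSelmerData κ₃ γ₃)
    (F : HeegnerFamily N₀ W₀ K₀ κ₃ jbar₀)
    (hTZ : ∀ j, ∑ i ∈ Finset.range 3, (γ₃ ^ (3 ^ j * i)) • F.z (j + 1) = 0) :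
    heegnerModule D F = ⊥ :=
  heegnerModule_eq_bot_of_traceZero_of_fixedPoints_eq_bot hγ
    (CumulativeHeegnerInclusionAtThreeCellNoThreeTorsion.cell_fixedPoints_kerSubgroup_eq_bot W₀ N₀ K₀ hO6 hline hN
      hK hHg κ₃) D F hTZ

end LeopoldtCell

/-! ## §6 (appended, lead g3) The CUMULATIVE Kummer family of a trace-zero family is `p`-norm-compatible:
temper exactly `1` in the compact-Selmer currency (companion of `…CumulativeClass.tr_cumulative_succ_iff`, p617614) -/

omit [W.IsElliptic] in
/-- **Norm of a restricted class**: for any `x ∈ ∏_m H¹(K_k, E[p^m])`,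
`Σ_{i<p} conj_{γ^{p^k i}} (res_{k→k+1} x) = res_{k→k+1} (p • x)` — `res` commutes with conjugation and `γ^{p^k i} ∈ Gal(K̄/K_k)`
acts trivially on `H¹(K_k, ·)` (`cor ∘ res = p`). [cite: PerrinRiou1987BSMF, §0 pp. 401–402 (res ∘ cor = N)]
[cite: SerreLocalFields1979, VII.§5 Prop. 3 (inner automorphisms act trivially)] -/
theorem sum_conjPi_resPi_eq_resPi_smul (hγ : κ.IsTopGenerator γ) (k : ℕ)
    (x : (W.baseChange K).torsionH1Pi p (κ.layerSubgroup k)) :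
    ∑ i ∈ Finset.range p, (W.baseChange K).conjPi p (κ.layerSubgroup (k + 1)) (γ ^ (p ^ k * i))
        ((W.baseChange K).resPi p (κ.layerSubgroup_antitone (Nat.le_succ k)) x) =
      (W.baseChange K).resPi p (κ.layerSubgroup_antitone (Nat.le_succ k)) ((p : ℤ) • x) := by
  have hconj : ∀ i ∈ Finset.range p,
      (W.baseChange K).conjPi p (κ.layerSubgroup (k + 1)) (γ ^ (p ^ k * i))
          ((W.baseChange K).resPi p (κ.layerSubgroup_antitone (Nat.le_succ k)) x) =
        (W.baseChange K).resPi p (κ.layerSubgroup_antitone (Nat.le_succ k)) x := by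
    intro i _
    rw [← resPi_conjPi, (W.baseChange K).conjPi_eq_self_of_mem p (κ.layerSubgroup k)
      (zpExtension_pow_pow_mul_mem_layerSubgroup p κ hγ k i)]
  rw [Finset.sum_congr rfl hconj, Finset.sum_const, Finset.card_range, ← natCast_zsmul, map_zsmul]

/-- **The norm of the Kummer family of a trace-zero norm point vanishes**: if `Tr_{K_{k+1}/K_k} z_{k+1} = 0` and `d`
is the Kummer family of `z_{k+1}` over `K_{k+1}`, then `Σ_{i<p} conj_{γ^{p^k i}} d = 0` (it is the Kummer family of
the trace, `IsKummerFamilyOver.sum` / `.conjPi`, i.e. of `0`). [cite: Howard2004HeegnerKolyvagin, §1 (the compact Kummer map is Gal-equivariant)] -/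
theorem sum_conjPi_eq_zero_of_isKummerFamilyOver_of_traceZero (F : HeegnerFamily N W K κ jbar) (k : ℕ)
    (hTZ : ∑ i ∈ Finset.range p, (γ ^ (p ^ k * i)) • F.z (k + 1) = 0)
    {d : (W.baseChange K).torsionH1Pi p (κ.layerSubgroup (k + 1))}
    (hd : (W.baseChange K).IsKummerFamilyOver p (κ.layerSubgroup (k + 1))
      (fun _ hσ ↦ (F.isHeegnerNormPoint_z (k + 1)).smul_eq_self hσ) d) :
    ∑ i ∈ Finset.range p, (W.baseChange K).conjPi p (κ.layerSubgroup (k + 1)) (γ ^ (p ^ k * i)) d = 0 := by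
  have hfix : ∀ (i : ℕ), ∀ τ ∈ κ.layerSubgroup (k + 1),
      τ • ((γ ^ (p ^ k * i)) • F.z (k + 1)) = (γ ^ (p ^ k * i)) • F.z (k + 1) := by
    intro i τ hτ
    rw [← mul_smul, show τ * γ ^ (p ^ k * i) = γ ^ (p ^ k * i) * ((γ ^ (p ^ k * i))⁻¹ * τ * γ ^ (p ^ k * i))
      by group, mul_smul, (F.isHeegnerNormPoint_z (k + 1)).smul_eq_self
      (conj_mem_of_normal (κ.layerSubgroup (k + 1)) (γ ^ (p ^ k * i)) ⟨τ, hτ⟩)]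
  have hsum := IsKummerFamilyOver.sum (p := p) (Finset.range p)
    (P := fun i ↦ (γ ^ (p ^ k * i)) • F.z (k + 1))
    (d := fun i ↦ (W.baseChange K).conjPi p (κ.layerSubgroup (k + 1)) (γ ^ (p ^ k * i)) d)
    (hP := hfix) (fun i ↦ hd.conjPi (γ ^ (p ^ k * i)))
  exact IsKummerFamilyOver.unique p (IsKummerFamilyOver.of_eq hTZ hsum)
    (isKummerFamilyOver_zero (V := W.baseChange K) (H' := κ.layerSubgroup (k + 1)) (p := p))

/-- **The cumulative Kummer family is `p`-norm-compatible (temper exactly `1`).** Let `c ∈ ∏_m H¹(K_k, E[p^m])` be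
ANY class (e.g. the cumulative class `Σ_{j≤k} res δ(z_j) + res δ(y)` at layer `k`) and `c' = res_{k→k+1} c + δ(z_{k+1})` the
next cumulative class, with `z_{k+1}` trace-zero. Then `Σ_{i<p} conj_{γ^{p^k i}} c' = res_{k→k+1} (p • c)`: the cumulative
family is norm-compatible only after dividing by one power of `p` per layer — the compact-Selmer form of the crux text's
«Tr y♮_{m+1} = 3·y♮_m» and of `…CumulativeClass.tr_cumulative_succ` (p617614), and the reason the integral module `ℋ_∞`
of §4 is `⊥` while the TEMPERED class `(p^{-k} c_k)_k` lives in `𝔖 ⊗ 𝓗₁` only.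
[cite: PerrinRiou1987BSMF, §3.4 (ℋ_n and traces)] [cite: Howard2004HeegnerKolyvagin, §3.3 (H_k)] -/
theorem sum_conjPi_cumulative_succ_eq_resPi_smul (hγ : κ.IsTopGenerator γ) (F : HeegnerFamily N W K κ jbar) (k : ℕ)
    (hTZ : ∑ i ∈ Finset.range p, (γ ^ (p ^ k * i)) • F.z (k + 1) = 0)
    (c : (W.baseChange K).torsionH1Pi p (κ.layerSubgroup k))
    {d : (W.baseChange K).torsionH1Pi p (κ.layerSubgroup (k + 1))}
    (hd : (W.baseChange K).IsKummerFamilyOver p (κ.layerSubgroup (k + 1))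
      (fun _ hσ ↦ (F.isHeegnerNormPoint_z (k + 1)).smul_eq_self hσ) d)
    {c' : (W.baseChange K).torsionH1Pi p (κ.layerSubgroup (k + 1))}
    (hc' : c' = (W.baseChange K).resPi p (κ.layerSubgroup_antitone (Nat.le_succ k)) c + d) :
    ∑ i ∈ Finset.range p, (W.baseChange K).conjPi p (κ.layerSubgroup (k + 1)) (γ ^ (p ^ k * i)) c' =
      (W.baseChange K).resPi p (κ.layerSubgroup_antitone (Nat.le_succ k)) ((p : ℤ) • c) := by
  rw [hc', sum_conjPi_add, sum_conjPi_resPi_eq_resPi_smul hγ k c,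
    sum_conjPi_eq_zero_of_isKummerFamilyOver_of_traceZero F k hTZ hd, add_zero]

end Summit.BirchSwinnertonDyer.BirchSwinnertonDyer.Theorems.CumulativeHeegnerInclusionAtThreeTraceZero

end
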